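import Summits.QuantumFields.BalabanUV.InfraRed.StrongCouplingSharpTwist

/-!
# Strong-coupling front, J-SC13 (part 2/3): the SHARP integrated Bochner inequality
`(3/2) ∫ e^S Γ(u,u) dσ ≤ ∫ e^S (L_S u)² dσ` for EVERY one-link potential on `SU(2)` —
observatory of the non-perturbative crossover; no mass-gap claim

IR-3 v2 TWO-FRONT CROSSOVER LEDGER, front SC (`β₀`), SU(2), `d = 4`, Wilson normalisation `β_W = 4/g²`.
observatory of the non-perturbative crossover; no mass-gap claim.

ABSOLUTE RULE. No internally-minted statement may enter as a cited fact. Every hypothesis is either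
kernel-proved in this package or a verbatim quotation of a PUBLISHED theorem with page reference. The
manuscript(s) under audit are NOT citable for their own disputed steps — they are the thing under
adjudication; programme-internal (2001/route/tribunal) claims are never citable.  THIS FILE HAS NO
HYPOTHESES: every statement below is kernel-proved from the tree (part 1/3 `StrongCouplingSharpTwist` and
the `SUNBakryEmery` integration-by-parts lemmas); names of published results appear as ATTRIBUTION only.

WHAT THIS FILE PROVES: `integral_exp_mul_Gam_le_sharp` — integrating part 1's pointwise twisted Bochner
inequality `Gam_le_twisted_pot` against `e^S dσ`, `S = pot c B = c Re tr(· B)`, and using the tree's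
integrations by parts (`∫ e^S (L_S u)² = ∫ e^S Γ₂`, `∫ F e^S L_S G = -∫ e^S Γ(F,G)`) together with
`Δ S = -(3/2) S`, ALL potential terms cancel exactly at the twist parameter `2/5`, and what is left is
`(3/2) ∫ e^S Γ(u,u) dσ ≤ ∫ e^S (L_S u)² dσ` for EVERY `c`, `B` — the HAAR constant `3/2`
(`= λ₁(S³)/2` in the tree's units), i.e. the hypothesis `hGam` of
`StrongCouplingDimensionalPoincare.poincare_pot_K` with `K = 3/2` and NO smallness condition on `B`.
(On the unit sphere `S³ ≅ SU(2)` this reads: the spectral gap of `e^{κ x·e} dσ` is `≥ 3 = λ₁(S³)` for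
every `κ`; on `Sⁿ` the same computation with twist `2/(n+2)` gives `≥ n`.)
Part 3/3 (`StrongCouplingSharpWindow`) turns this into `OneLinkPoincareSU2 R (2/3)` for every `R`
(in particular the typed target `SharpPoincareSU2`) and the hypothesis-free window `β_W < √3/9 = 0.19245`
of the ledger through the landed doors of J-SC11, past J-SC12's `β_W < √(13/696) = 0.13667`.
-/

noncomputable section

open scoped Matrix ComplexConjugate BigOperators Matrix.Norms.Frobenius ContDiff Topology
open Matrix Complex Finset MeasureTheory
open Literature.MathematicalPhysics.QuantumFieldTheory
open Literature.MathematicalPhysics.QuantumFieldTheory.SUNBakryEmery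
open Summit.QuantumFields.BalabanUV.InfraRed.StrongCouplingDimensionalCurvature
open Summit.QuantumFields.BalabanUV.InfraRed.StrongCouplingSharpTwist

namespace Summit.QuantumFields.BalabanUV.InfraRed.StrongCouplingSharpCurvature

/-! ## Part B: the sharp integrated Bochner inequality -/

/-- **The sharp integrated Bochner (Poincaré–Lichnerowicz) inequality for EVERY one-link Gibbs measure on
`SU(2)`**: for `S = pot c B = c Re tr(· B)` with ANY `c ∈ ℝ`, `B ∈ M₂(ℂ)`, and every smooth `u`,
`(3/2) ∫ e^S Γ(u,u) dσ ≤ ∫ e^S (L_S u)² dσ` — the Haar value `3/2` of the constant (attained at `B = 0`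
by `u = Re tr(· E)`), with no smallness condition.  Proof: integrate `Gam_le_twisted_pot` against
`e^S dσ`; by the tree's integrations by parts `∫ e^S (L_S u)² = ∫ e^S Γ₂`,
`∫ e^S Γ(S,Γ(u,u)) = -∫ e^S (L_S S) Γ(u,u) = ∫ e^S ((3/2)S - Γ(S,S)) Γ(u,u)` and
`∫ e^S (L_S u) Γ(S,u) = -∫ e^S Γ(Γ(S,u),u) = ∫ e^S (-S/4 + Γ(S,S)/2) Γ(u,u)`, after which every
potential term cancels.  This is the hypothesis `hGam` of `StrongCouplingDimensionalPoincare.poincare_pot_K`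
with `K = 3/2`. [folklore] -/
theorem integral_exp_mul_Gam_le_sharp (c : ℝ) (B : Matrix (Fin 2) (Fin 2) ℂ) {u : Matrix (Fin 2) (Fin 2) ℂ → ℝ}
    (hu : ContDiff ℝ ∞ u) :
    (3 / 2) * ∫ g : SUN 2, Real.exp (pot c B g) * Gam u u g ∂(haarSU 2) ≤
      ∫ g : SUN 2, Real.exp (pot c B g) * genL (pot c B) u g ^ 2 ∂(haarSU 2) := by
  have hS : ContDiff ℝ ∞ (pot (N := 2) c B) := contDiff_pot c B
  -- integrability of the atoms
  have hwint : ∀ {f : Matrix (Fin 2) (Fin 2) ℂ → ℝ}, ContDiff ℝ ∞ f →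
      Integrable (fun g : SUN 2 => Real.exp (pot c B g) * f g) (haarSU 2) :=
    fun hf => integrable_of_continuous_SUN (continuous_restrict (hS.exp.mul hf)) _
  have hG2c : ContDiff ℝ ∞ (Gam2 (pot (N := 2) c B) u) := by
    have e : Gam2 (pot (N := 2) c B) u = fun Q => (1 / 2) * genL (pot c B) (Gam u u) Q - Gam u (genL (pot c B) u) Q := rfl
    rw [e]
    exact (contDiff_const.mul (contDiff_genL hS (contDiff_Gam hu hu))).sub (contDiff_Gam hu (contDiff_genL hS hu))
  have i1 : Integrable (fun g : SUN 2 => Real.exp (pot c B g) * genL (pot c B) u g ^ 2) (haarSU 2) :=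
    hwint (f := fun Q => genL (pot c B) u Q ^ 2) ((contDiff_genL hS hu).pow 2)
  have i2 : Integrable (fun g : SUN 2 => Real.exp (pot c B g) * Gam u u g) (haarSU 2) :=
    hwint (f := Gam u u) (contDiff_Gam hu hu)
  have i3 : Integrable (fun g : SUN 2 => Real.exp (pot c B g) * (pot c B g * Gam u u g)) (haarSU 2) :=
    hwint (f := fun Q => pot c B Q * Gam u u Q) (hS.mul (contDiff_Gam hu hu))
  have i4 : Integrable (fun g : SUN 2 => Real.exp (pot c B g) * (Gam (pot c B) (pot c B) g * Gam u u g)) (haarSU 2) :=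
    hwint (f := fun Q => Gam (pot c B) (pot c B) Q * Gam u u Q) ((contDiff_Gam hS hS).mul (contDiff_Gam hu hu))
  have iG : Integrable (fun g : SUN 2 => Real.exp (pot c B g) * Gam2 (pot c B) u g) (haarSU 2) :=
    hwint (f := Gam2 (pot c B) u) hG2c
  have iX : Integrable (fun g : SUN 2 => Real.exp (pot c B g) * Gam (pot c B) (Gam u u) g) (haarSU 2) :=
    hwint (f := Gam (pot c B) (Gam u u)) (contDiff_Gam hS (contDiff_Gam hu hu))
  have iL : Integrable (fun g : SUN 2 => Real.exp (pot c B g) * (genL (pot c B) u g * Gam (pot c B) u g)) (haarSU 2) :=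
    hwint (f := fun Q => genL (pot c B) u Q * Gam (pot c B) u Q) ((contDiff_genL hS hu).mul (contDiff_Gam hS hu))
  -- (0) the integrated Bochner formula
  have h0 : ∫ g : SUN 2, Real.exp (pot c B g) * genL (pot c B) u g ^ 2 ∂(haarSU 2) =
      ∫ g : SUN 2, Real.exp (pot c B g) * Gam2 (pot c B) u g ∂(haarSU 2) :=
    integral_exp_mul_genL_sq two_ne_zero hS hu
  -- (1) `∫ e^S Γ(S,Γ(u,u)) = (3/2) ∫ e^S S Γ(u,u) - ∫ e^S Γ(S,S) Γ(u,u)`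
  have h1 : ∫ g : SUN 2, Real.exp (pot c B g) * Gam (pot c B) (Gam u u) g ∂(haarSU 2) =
      (3 / 2) * ∫ g : SUN 2, Real.exp (pot c B g) * (pot c B g * Gam u u g) ∂(haarSU 2) -
        ∫ g : SUN 2, Real.exp (pot c B g) * (Gam (pot c B) (pot c B) g * Gam u u g) ∂(haarSU 2) := by
    have h := integral_mul_exp_mul_genL two_ne_zero hS (contDiff_Gam hu hu) hS
    have e : ∀ g : SUN 2, Gam u u g * (Real.exp (pot c B g) * genL (pot c B) (pot c B) g) =
        -((3 / 2) * (Real.exp (pot c B g) * (pot c B g * Gam u u g))) +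
          Real.exp (pot c B g) * (Gam (pot c B) (pot c B) g * Gam u u g) := by
      intro g
      rw [genL_pot_self]
      ring
    have e' : ∀ g : SUN 2, Real.exp (pot c B g) * Gam (Gam u u) (pot c B) g =
        Real.exp (pot c B g) * Gam (pot c B) (Gam u u) g := by
      intro g
      rw [Gam_comm (Gam u u) (pot c B)]
    simp_rw [e, e'] at h
    have i3n : Integrable (fun g : SUN 2 => -((3 / 2) * (Real.exp (pot c B g) * (pot c B g * Gam u u g)))) (haarSU 2) :=
      (i3.const_mul (3 / 2)).neg
    rw [integral_add i3n i4, integral_neg, integral_const_mul] at h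
    linarith
  -- (2) `∫ e^S (L_S u) Γ(S,u) = (1/2) ∫ e^S S Γ(u,u) - (1/2) ∫ e^S Γ(S,Γ(u,u))`
  have h2 : ∫ g : SUN 2, Real.exp (pot c B g) * (genL (pot c B) u g * Gam (pot c B) u g) ∂(haarSU 2) =
      (1 / 2) * ∫ g : SUN 2, Real.exp (pot c B g) * (pot c B g * Gam u u g) ∂(haarSU 2) -
        (1 / 2) * ∫ g : SUN 2, Real.exp (pot c B g) * Gam (pot c B) (Gam u u) g ∂(haarSU 2) := by
    have h := integral_mul_exp_mul_genL two_ne_zero hS (contDiff_Gam hS hu) hu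
    have e : ∀ g : SUN 2, Gam (pot c B) u g * (Real.exp (pot c B g) * genL (pot c B) u g) =
        Real.exp (pot c B g) * (genL (pot c B) u g * Gam (pot c B) u g) := fun g => by ring
    have e' : ∀ g : SUN 2, Real.exp (pot c B g) * Gam (Gam (pot c B) u) u g =
        -((1 / 2) * (Real.exp (pot c B g) * (pot c B g * Gam u u g))) +
          (1 / 2) * (Real.exp (pot c B g) * Gam (pot c B) (Gam u u) g) := by
      intro g
      rw [Gam_Gam_left_pot c B hu]
      ring
    simp_rw [e, e'] at h
    have i3n : Integrable (fun g : SUN 2 => -((1 / 2) * (Real.exp (pot c B g) * (pot c B g * Gam u u g)))) (haarSU 2) :=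
      (i3.const_mul (1 / 2)).neg
    rw [integral_add i3n (iX.const_mul (1 / 2)), integral_neg, integral_const_mul, integral_const_mul] at h
    linarith
  -- (3) the pointwise inequality, integrated
  have h3 : ∫ g : SUN 2, Real.exp (pot c B g) * Gam u u g ∂(haarSU 2) ≤
      ∫ g : SUN 2, Real.exp (pot c B g) * Gam2 (pot c B) u g ∂(haarSU 2) +
        (2 / 5) * ∫ g : SUN 2, Real.exp (pot c B g) * Gam (pot c B) (Gam u u) g ∂(haarSU 2) +
        (1 / 5) * ∫ g : SUN 2, Real.exp (pot c B g) * (Gam (pot c B) (pot c B) g * Gam u u g) ∂(haarSU 2) -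
        (1 / 2) * ∫ g : SUN 2, Real.exp (pot c B g) * (pot c B g * Gam u u g) ∂(haarSU 2) -
        (1 / 3) * ∫ g : SUN 2, Real.exp (pot c B g) * genL (pot c B) u g ^ 2 ∂(haarSU 2) +
        (2 / 5) * ∫ g : SUN 2, Real.exp (pot c B g) * (genL (pot c B) u g * Gam (pot c B) u g) ∂(haarSU 2) := by
    have hpt : ∀ g : SUN 2, Real.exp (pot c B g) * Gam u u g ≤
        Real.exp (pot c B g) * Gam2 (pot c B) u g +
          (2 / 5) * (Real.exp (pot c B g) * Gam (pot c B) (Gam u u) g) +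
          (1 / 5) * (Real.exp (pot c B g) * (Gam (pot c B) (pot c B) g * Gam u u g)) -
          (1 / 2) * (Real.exp (pot c B g) * (pot c B g * Gam u u g)) -
          (1 / 3) * (Real.exp (pot c B g) * genL (pot c B) u g ^ 2) +
          (2 / 5) * (Real.exp (pot c B g) * (genL (pot c B) u g * Gam (pot c B) u g)) := by
      intro g
      have h := Gam_le_twisted_pot c B hu (g : Matrix (Fin 2) (Fin 2) ℂ)
      have hw := mul_le_mul_of_nonneg_left h (Real.exp_pos (pot c B g)).le
      linarith
    have iS2 : Integrable (fun g : SUN 2 => Real.exp (pot c B g) * Gam2 (pot c B) u g +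
          (2 / 5) * (Real.exp (pot c B g) * Gam (pot c B) (Gam u u) g)) (haarSU 2) :=
      iG.add (iX.const_mul (2 / 5))
    have iS3 : Integrable (fun g : SUN 2 => Real.exp (pot c B g) * Gam2 (pot c B) u g +
          (2 / 5) * (Real.exp (pot c B g) * Gam (pot c B) (Gam u u) g) +
          (1 / 5) * (Real.exp (pot c B g) * (Gam (pot c B) (pot c B) g * Gam u u g))) (haarSU 2) :=
      iS2.add (i4.const_mul (1 / 5))
    have iS4 : Integrable (fun g : SUN 2 => Real.exp (pot c B g) * Gam2 (pot c B) u g +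
          (2 / 5) * (Real.exp (pot c B g) * Gam (pot c B) (Gam u u) g) +
          (1 / 5) * (Real.exp (pot c B g) * (Gam (pot c B) (pot c B) g * Gam u u g)) -
          (1 / 2) * (Real.exp (pot c B g) * (pot c B g * Gam u u g))) (haarSU 2) :=
      iS3.sub (i3.const_mul (1 / 2))
    have iS5 : Integrable (fun g : SUN 2 => Real.exp (pot c B g) * Gam2 (pot c B) u g +
          (2 / 5) * (Real.exp (pot c B g) * Gam (pot c B) (Gam u u) g) +
          (1 / 5) * (Real.exp (pot c B g) * (Gam (pot c B) (pot c B) g * Gam u u g)) -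
          (1 / 2) * (Real.exp (pot c B g) * (pot c B g * Gam u u g)) -
          (1 / 3) * (Real.exp (pot c B g) * genL (pot c B) u g ^ 2)) (haarSU 2) :=
      iS4.sub (i1.const_mul (1 / 3))
    have iR : Integrable (fun g : SUN 2 => Real.exp (pot c B g) * Gam2 (pot c B) u g +
          (2 / 5) * (Real.exp (pot c B g) * Gam (pot c B) (Gam u u) g) +
          (1 / 5) * (Real.exp (pot c B g) * (Gam (pot c B) (pot c B) g * Gam u u g)) -
          (1 / 2) * (Real.exp (pot c B g) * (pot c B g * Gam u u g)) -
          (1 / 3) * (Real.exp (pot c B g) * genL (pot c B) u g ^ 2) +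
          (2 / 5) * (Real.exp (pot c B g) * (genL (pot c B) u g * Gam (pot c B) u g))) (haarSU 2) :=
      iS5.add (iL.const_mul (2 / 5))
    have hm := integral_mono i2 iR hpt
    rw [integral_add iS5 (iL.const_mul (2 / 5)), integral_sub iS4 (i1.const_mul (1 / 3)),
      integral_sub iS3 (i3.const_mul (1 / 2)), integral_add iS2 (i4.const_mul (1 / 5)),
      integral_add iG (iX.const_mul (2 / 5)),
      integral_const_mul, integral_const_mul, integral_const_mul, integral_const_mul, integral_const_mul] at hm
    exact hm
  linarith [h0, h1, h2, h3]

end Summit.QuantumFields.BalabanUV.InfraRed.StrongCouplingSharpCurvature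

end
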